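import Summits.Ventures.LatticeQCDFlow.Scoring.U1TopSusceptibilityCertificate
import HarnessLib

/-!
# A kernel-checkable certificate for the infinite-volume susceptibility `χ_∞(β) = 1/12 + κ₀(β)/(2π² I₀(β))` of 2-d `U(1)`

HONEST FRAMING: exact (Metropolis-corrected) sampling algorithms for lattice gauge theory;
figures of merit are autocorrelation/cost numbers at stated couplings and volumes; no
continuum-physics claim.

Venture `LatticeQCDFlow` (cell pub-lqcd), sub-topic `Scoring`; FANOUT row 5 (`s0-sun-a`), GEN-14.
NEW WORK of the cell (placement rule).  `Scoring/U1TorusTopologicalSusceptibilityFiniteVolume.lean`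
shows `χ_t(L, β) → χ_∞(β) = 1/12 + κ₀(β)/(2π² I₀(β)) = ⟨θ²⟩_β/(4π²)` exponentially fast in `V = L²`,
`κ₀(β) = Σ_{m≠0} (−1)^m I_{|m|}(β)/m²`.  In the ratios `r_m = I_m/I₀` of
`Scoring/BesselIRatioLadder.lean`, `κ₀/I₀ = Σ_{m∈ℤ} r_{|m|} (−1)^m/m²` is one window sum plus a tail
(`Scoring/RatioSeriesTailBounds.lean`), so the same rational machinery as for `⟨Q²⟩`
(`Scoring/U1TopSusceptibilityCertificate.lean`, here with `V/(4π²)` at `V = 2`) gives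

* **`chiInf_mem_of_cert`** — ladder term ∧ certificate term `= true` ⇒
  `lo ≤ 1/12 + κ₀(x)/(2π² I₀(x)) ≤ hi`.

Instances by `decide +kernel`: `Scoring/U1TopSusceptibilityInfiniteVolumeEnclosures*.lean`.
Elementary given the parents; nothing is cited.
-/

noncomputable section

open Real Finset
open Literature.Analysis.FunctionSpaces

namespace Summit.Ventures.LatticeQCDFlow.Scoring

/-- **SOUNDNESS OF THE `χ_∞` CERTIFICATE.**  With the ratio tables `ρd, rd` of order `M`, a width `ε`
and claimed `lo, hi`: the certificate term computes `θ = x/(2(M+1))`, `T2 = 2 b_M θ/(1−θ)`,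
`η = (2M+1)ε + T2`, the window sum `A = Σ_{i<2M+1} a_{|i−M|} (−1)^{i−M}/(i−M)²`, and checks
`lo ≤ 1/12 + min(2(A−η)/(4U²), 2(A−η)/(4D²))`, `1/12 + max(2(A+η)/(4D²), 2(A+η)/(4U²)) ≤ hi`
(`D = 3.14159265358979323846 ≤ π ≤ U = …847`). -/
theorem chiInf_mem_of_cert {x ε lo hi : ℚ} {M : ℕ} {ρd rd : ℕ → ℚ × ℚ}
    (hratio : (decide (0 < x) && decide (ρd (M + 1) = (0, x / (2 * (M + 1)))) && decide (rd 0 = (1, 1)) &&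
      (List.range M).all (fun i =>
        decide (0 ≤ (ρd (i + 1)).1) && decide (0 ≤ (ρd (i + 2)).1) &&
        decide ((ρd (i + 1)).1 * (2 * (i + 1 : ℕ) / x + (ρd (i + 2)).2) ≤ 1) &&
        decide (1 ≤ (ρd (i + 1)).2 * (2 * (i + 1 : ℕ) / x + (ρd (i + 2)).1)) &&
        decide (0 ≤ (rd (i + 1)).1) && decide ((rd (i + 1)).1 ≤ (rd i).1 * (ρd (i + 1)).1) &&
        decide ((rd i).2 * (ρd (i + 1)).2 ≤ (rd (i + 1)).2))) = true)
    (hcert : (let θ : ℚ := x / (2 * (M + 1))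
      let T2 : ℚ := 2 * ((rd M).2 * θ / (1 - θ))
      let η : ℚ := (2 * M + 1) * ε + T2
      let A : ℚ := ∑ j ∈ Finset.range (2 * M + 1),
        (rd ((j : ℤ) - M).natAbs).1 *
          ((-1 : ℚ) ^ ((0 : ℤ) + ((j : ℤ) - M)) / ((((0 : ℤ) + ((j : ℤ) - M) : ℤ) : ℚ) ^ 2))
      let D : ℚ := 3.14159265358979323846
      let U : ℚ := 3.14159265358979323847
      let Q₁ : ℚ := 1 / 12 + min (2 * (A - η) / (4 * U ^ 2)) (2 * (A - η) / (4 * D ^ 2))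
      let Q₂ : ℚ := 1 / 12 + max (2 * (A + η) / (4 * D ^ 2)) (2 * (A + η) / (4 * U ^ 2))
      decide (0 < x) && decide (x < 2 * (M + 1)) && decide (0 ≤ ε) &&
        (List.range (M + 1)).all (fun k => decide ((rd k).2 - (rd k).1 ≤ ε)) &&
        decide (lo ≤ Q₁) && decide (Q₂ ≤ hi)) = true) :
    ((lo : ℚ) : ℝ) ≤ 1 / 12 + (∑' m : ℤ, besselI m.natAbs ((x : ℚ) : ℝ) *
        ((-1 : ℝ) ^ ((0 : ℤ) + m) / (((0 : ℤ) + m : ℤ) : ℝ) ^ 2)) / (2 * π ^ 2 * besselI 0 ((x : ℚ) : ℝ)) ∧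
      1 / 12 + (∑' m : ℤ, besselI m.natAbs ((x : ℚ) : ℝ) *
        ((-1 : ℝ) ^ ((0 : ℤ) + m) / (((0 : ℤ) + m : ℤ) : ℝ) ^ 2)) / (2 * π ^ 2 * besselI 0 ((x : ℚ) : ℝ)) ≤
        ((hi : ℚ) : ℝ) := by
  simp only [Bool.and_eq_true, decide_eq_true_eq, List.all_eq_true, List.mem_range] at hcert
  obtain ⟨⟨⟨⟨⟨hx0, hxM⟩, hε0⟩, hwid⟩, hlo⟩, hhi⟩ := hcert
  have hx' : (0 : ℝ) < ((x : ℚ) : ℝ) := by exact_mod_cast hx0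
  have hI0 : 0 < besselI 0 ((x : ℚ) : ℝ) := besselI_pos 0 hx'
  set r : ℕ → ℝ := fun k => besselI k ((x : ℚ) : ℝ) / besselI 0 ((x : ℚ) : ℝ) with hr
  set a : ℕ → ℝ := fun k => (((rd k).1 : ℚ) : ℝ) with ha
  set b : ℕ → ℝ := fun k => (((rd k).2 : ℚ) : ℝ) with hb
  set θ : ℝ := ((x : ℚ) : ℝ) / (2 * (M + 1)) with hθ
  obtain ⟨h0, h1, hdec', hs⟩ := besselRatioSeq_props hx' M
  have hdec : ∀ k, M ≤ k → r (k + 1) ≤ θ * r k := fun k hk => hdec' k hk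
  have hθ0 : 0 ≤ θ := by rw [hθ]; positivity
  have hθ1 : θ < 1 := by
    rw [hθ, div_lt_one (by positivity)]
    have : ((x : ℚ) : ℝ) < ((2 * (M + 1) : ℚ) : ℝ) := by exact_mod_cast hxM
    push_cast at this
    exact this
  have hab : ∀ k, k ≤ M → a k ≤ r k ∧ r k ≤ b k := fun k hk => by
    obtain ⟨_, h2, h3⟩ := besselRatio_sound hratio k hk
    exact ⟨h2, h3⟩
  have hεR : ∀ k, k ≤ M → b k - a k ≤ ((ε : ℚ) : ℝ) := fun k hk => by
    have := hwid k (by omega)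
    show (((rd k).2 : ℚ) : ℝ) - (((rd k).1 : ℚ) : ℝ) ≤ ((ε : ℚ) : ℝ)
    exact_mod_cast this
  set T : ℝ := b M * θ / (1 - θ) with hT
  set η : ℝ := (2 * M + 1) * ((ε : ℚ) : ℝ) + 2 * T with hη
  set A : ℝ := (∑ j ∈ Finset.range (2 * M + 1), a ((j : ℤ) - M).natAbs *
    ((-1 : ℝ) ^ ((0 : ℤ) + ((j : ℤ) - M)) / ((((0 : ℤ) + ((j : ℤ) - M) : ℤ) : ℝ) ^ 2))) with hA
  -- the rescaled series and its truncation
  have hc : ∀ m : ℤ, |(-1 : ℝ) ^ ((0 : ℤ) + m) / (((0 : ℤ) + m : ℤ) : ℝ) ^ 2| ≤ 1 := fun m =>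
    abs_neg_one_zpow_div_sq_le ((0 : ℤ) + m)
  have htr : |∑' m : ℤ, r m.natAbs * ((-1 : ℝ) ^ ((0 : ℤ) + m) / (((0 : ℤ) + m : ℤ) : ℝ) ^ 2) - A| ≤ η :=
    abs_tsum_sub_truncation_le h0 hdec hθ0 hθ1 hab hεR hs hc
  have hresc : (∑' m : ℤ, besselI m.natAbs ((x : ℚ) : ℝ) *
        ((-1 : ℝ) ^ ((0 : ℤ) + m) / (((0 : ℤ) + m : ℤ) : ℝ) ^ 2)) / (2 * π ^ 2 * besselI 0 ((x : ℚ) : ℝ)) =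
      2 / (4 * π ^ 2) * ∑' m : ℤ, r m.natAbs * ((-1 : ℝ) ^ ((0 : ℤ) + m) / (((0 : ℤ) + m : ℤ) : ℝ) ^ 2) := by
    have e : ∑' m : ℤ, besselI m.natAbs ((x : ℚ) : ℝ) *
        ((-1 : ℝ) ^ ((0 : ℤ) + m) / (((0 : ℤ) + m : ℤ) : ℝ) ^ 2) =
        besselI 0 ((x : ℚ) : ℝ) * ∑' m : ℤ, r m.natAbs *
          ((-1 : ℝ) ^ ((0 : ℤ) + m) / (((0 : ℤ) + m : ℤ) : ℝ) ^ 2) := by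
      rw [← tsum_mul_left]; refine tsum_congr fun m => ?_; rw [hr]; field_simp
    rw [e]; field_simp; ring
  obtain ⟨hlo', hhi'⟩ := abs_le.1 htr
  have hπfac := pi_factor_mem (V := (2 : ℝ)) (D := (3.14159265358979323846 : ℝ))
    (U := (3.14159265358979323847 : ℝ)) (by norm_num) Real.pi_gt_d20.le Real.pi_lt_d20.le
    (by norm_num) (q₁ := A - η) (q₂ := A + η)
    (q := ∑' m : ℤ, r m.natAbs * ((-1 : ℝ) ^ ((0 : ℤ) + m) / (((0 : ℤ) + m : ℤ) : ℝ) ^ 2))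
    (by linarith) (by linarith)
  have hloR := (Rat.cast_le (K := ℝ)).mpr hlo
  have hhiR := (Rat.cast_le (K := ℝ)).mpr hhi
  rw [hresc]
  simp only [hr, ha, hb, hθ, hT, hη, hA] at hπfac
  push_cast at hloR hhiR hπfac ⊢
  constructor
  · linarith [hπfac.1, hloR]
  · linarith [hπfac.2, hhiR]

end Summit.Ventures.LatticeQCDFlow.Scoring
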